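/-
Copyright (c) 2026 the pub-hodgecm-mathlib formalisation cell (harness21).  Prover seat hodgecm-mathlib-A-p13 (g38), line LD1
(`Cruxes/HLiu418/Lines/F0_P6LD_StubS1FactsThetaRoad`, organ (L) «line pin», brick (L-T2)), 2026-09-02.  KERNEL module:
THEOREMS ONLY (no definition, no named fact, no instance, no notation, no `sorry`).
-/
import Literature.NumberTheory.Automorphic.Liu2021.ThetaLiftFromLineSeamTransport
import Literature.NumberTheory.Automorphic.Liu2021.Def411WeilCarriersFrameTransport
import Literature.NumberTheory.GelbartRogawski1991.DoubledKroneckerConjugationFrame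
import Literature.NumberTheory.GelbartRogawski1991.DoubledWeilRepresentationIsometryTransportModel
import Literature.NumberTheory.GelbartRogawski1991.DoubledKroneckerConjugationOmega
import HarnessLib

-- As in the lineage (`ThetaLiftFromLineCharacters`, `ThetaLiftFromLineSeamTransport`): statements over the theta-kernel datum and the
-- doubled Weil machinery elaborate to very large types; elaborate sequentially.
set_option Elab.async false

/-!
# The seam `MeetsThetaLiftFromLine` does not see the rational frame of `V` (brick (L-T2) of LD1 organ (L))

Topic `NumberTheory/Automorphic/Liu2021`; namespaces `Literature.NumberTheory.Automorphic.Liu2021.Def411WeilCarriersDoubling` (§3) and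
`Literature.NumberTheory.Automorphic.Liu2021` (§4); sequel of ★ `ThetaLiftFromLineSeamTransport` (§1 kernels, §2 `MeetsThetaLiftFromLine.transport`).
THEOREMS ONLY.  Cell hodgecm-mathlib FLOOR 0, crux `HLiu418` (stmt-HodgeConjecture-24832), socket 27458 `F0_AlbCm.stub_S1_facts` (#73),
LD1 in-house θ-road (organ (L) `ThetaLinePinned₂`; also LD1-p01's «scaled-frame gap»: the letter's frame `ᵗḡ(t•H)g = diag d_V` versus the
unscaled frames of ★ `ThetaLiftFromLineCharacters` §3–§6).

[Liu2021, App. D §D.1 Step 1, footnote l. 5215]: «the isomorphism class of `ω(μ, ε, χ)` depends only on `(μ, ε, χ)`» — in particular not on the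
basis of `V` in which the hermitian form is written.  For the χ-attached GLOBAL Weil representation this is the tree's doubled isometry transport
(★ `DoubledWeilRepresentationIsometryTransportModel.conjSplitting_doubledWeilRep_comp_thetaD`, HYPOTHESIS-FREE: the `χ`-normalised doubled Weil
representation of [Kudla1994, Thm. 3.1] is unique, ★ `isDoubledWeilRep_unique`, hence commutes with the isometry `B⁻¹ ⊗ 1`) read as the
Kronecker operator identity ★ `DoubledKroneckerConjugationOmega.hω_of_T4`:
`ω(r_Kron) (R_e⁻¹ (ω(s_χ[d_V′] p′) (R_e Ψ))) = R_e⁻¹ (ω(s_χ[d_V] (Ad(B⁻¹ ⊗ 1) p′)) (R_e (ω(r_Kron) Ψ)))` with `r_Kron = r_{L⁺}(Ad(B⁻¹ ⊗ 1))` Weil's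
Θ-FIXING rational lift ([Weil1964, n° 41 Thm. 6]).  THIS FILE feeds that identity to ★ `MeetsThetaLiftFromLine.transport`:

* §3 `omega_pairSplitting_splittingCongr` — the Weil operators of a splitting transported along equal W-side Gram data (`splittingCongr`, a cast)
  are those of the splitting, the member `U(J_W)(𝔸)` retyped along `J_W₁ = J_W₂` (`subst`; `rfl`); `omega_pairSplitting_chiSplittingLine` — at the
  LINE `⟨T_W⟩` the pair representation of `chiSplittingLine` IS the model pair representation of `chiSplitting[lineW T_W]`.
* §4 **`MeetsThetaLiftFromLine.frameTransport`** — for real diagonal frames `d_V′`, `d_V` related by a rational isometry `B`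
  (`formCongr c̄ B (1 • diag d_V′) = diag d_V`, the socket form of ★ `chiSplittingFrameTransport`) and any line `⟨a⟩`:
  `MeetsThetaLiftFromLine … d_V′ … P μ hμ a ιA′ → MeetsThetaLiftFromLine … d_V … P μ hμ a (Ad(B⁻¹ ⊗ 1) ∘ ιA′)` (given Weil's majorants at `d_V`,
  ★ `hasThetaMajorants_lineThetaKernelDatum`), with `R := R_{e₁} ∘ ω(r_Kron) ∘ R_{e₁}⁻¹` (`Θ ∘ R = Θ`: ★ `thetaDist_omega_ratPointsThetaLiftCont`,
  ★ `thetaDistLM_piSBReindex`), `θ_V := adelicIsometryConj (aOfB B)`, `θ_W := id`.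

HONEST SCOPE.  Nothing of [Liu2021] is asserted; no new letter.  The W-side rescaling `(d_V, a·c) ≡ (c•d_V, a)` of the χ-splitting ((L-T1)) is NOT
here.  HC_CM is proved only modulo the printed citations (2 remaining named inputs hLiu418 24832, h413 24833) until rung 0 closes; count-neutral.

## References
* [Liu2021] Y. Liu, Camb. J. Math. 9 (2021) = arXiv:2102.11518, Def. 4.11 (l. 2092–2096); App. D §D.1 Steps 1–2 (l. 5215–5219); Thm. B.4 (2).
* [GelbartRogawski1991] S. Gelbart, J. Rogawski, Invent. Math. 105 (1991), §3.1 Prop. 3.1.1 p. 455, Remark p. 457; §3.2 p. 457.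
* [Kudla1994] S. Kudla, Israel J. Math. 87 (1994), §2, Thm. 3.1.
* [Weil1964] A. Weil, Acta Math. 111 (1964), Chap. III n° 40–41, Thm. 6 p. 193.
* [PlatonovRapinchuk1994] V. Platonov, A. Rapinchuk, *Algebraic Groups and Number Theory* (1994), §5.1.
-/

set_option autoImplicit false

noncomputable section

open NumberField MeasureTheory IsDedekindDomain
open scoped Matrix Kronecker ComplexOrder ENNReal

/-! ## §3 The bridge to the model: the pair representation at the line `⟨T_W⟩` read at `dW := lineW T_W` -/

namespace Literature.NumberTheory.Automorphic.Liu2021.Def411WeilCarriersDoubling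

open _root_.MeasureTheory
open Literature.NumberTheory.Automorphic Literature.NumberTheory.Automorphic.UnitaryGroup
open Literature.NumberTheory.GelbartRogawski1991 Literature.NumberTheory.GelbartRogawski1991.UnitaryDualPair
open Literature.NumberTheory.GelbartRogawski1991.GRConstruction
open Literature.NumberTheory.Weil1964
open Literature.NumberTheory.GaloisRepresentations
open Literature.RepresentationTheory.HarrisKudlaSweet1996
open Literature.RepresentationTheory.HeisenbergGroup

section Bridge

variable {F E : Type} [Field F] [NumberField F] [Field E] [NumberField E] [Algebra F E]
  {c : E ≃ₐ[F] E} {N M n : ℕ} {e : Fin N × Fin M ≃ Fin n} {JV : Matrix (Fin N) (Fin N) E}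
  {TV : Matrix (Fin N) (Fin N) F} {TW₁ TW₂ : Matrix (Fin M) (Fin M) F} {JW₁ JW₂ : Matrix (Fin M) (Fin M) E}

/-- **the Weil operators of a splitting transported along equal W-side Gram data are those of the splitting** (`splittingCongr` is a
cast; the second member is retyped along `J_W₁ = J_W₂`). [cite: GelbartRogawski1991, §3.1 Prop. 3.1.1 p. 455 L1–3; Remark p. 457 L4] -/
theorem omega_pairSplitting_splittingCongr (hT : TW₁ = TW₂) (hJ : JW₁ = JW₂)
    (s : UnitaryGroup.adelicPair F E c N M JV JW₁ →* adelicMpCont F (Fin n) (adelicGram F e TV TW₁))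
    (k : UnitaryGroup.adelic F E c N JV) (u : UnitaryGroup.adelic F E c M JW₂) (Φ : piSchwartzBruhat F (Fin n)) :
    adelicMpCont.omega F (Fin n) (adelicGram F e TV TW₂)
        (pairSplitting F E c N M e JV JW₂ (splittingCongr F E c N M e JV hT hJ s) (k, u)) Φ =
      adelicMpCont.omega F (Fin n) (adelicGram F e TV TW₁)
        (pairSplitting F E c N M e JV JW₁ s
          (k, (MulEquiv.subgroupCongr (congrArg (UnitaryGroup.adelic F E c M) hJ)).symm u)) Φ := by
  subst hT hJ
  rfl

end Bridge

section Line

variable (L : Type) [Field L] [NumberField L] [IsCMField L] {N' n' : ℕ} (e₁ : Fin N' × Fin 1 ≃ Fin n')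
  (dV₁ : Fin N' → L) (hdV₁ : ∀ i, IsCMField.complexConj L (dV₁ i) = dV₁ i) (hdV₁0 : ∀ i, dV₁ i ≠ 0)

/-- **the pair representation at the LINE `⟨T_W⟩` IS the model pair representation at `dW := lineW T_W`** (`chiSplittingLine` unfolds to
`splittingCongr … (chiSplitting … (lineW T_W) …)`; the member `U(J_W)(𝔸)` is retyped along `diagonal (lineW T_W) = J_W`).
[cite: Liu2021, App. D §D.1 Steps 1–2 (l. 5217–5219)] [cite: GelbartRogawski1991, §3.1 Prop. 3.1.1 p. 455 L1–3] -/
theorem omega_pairSplitting_chiSplittingLine (χ : HeckeCharacter L) (hχu : χ.IsUnitary) (hχs : IsSplittingChar L 1 χ)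
    (TW : Matrix (Fin 1) (Fin 1) (Fp L)) (hWd : IsUnit TW.det) (JW : Matrix (Fin 1) (Fin 1) L)
    (hJW : JW = TW.map (algebraMap (Fp L) L)) (k : UnitaryGroup.adelic (Fp L) L (IsCMField.complexConj L) N' (Matrix.diagonal dV₁))
    (u : UnitaryGroup.adelic (Fp L) L (IsCMField.complexConj L) 1 JW) (Φ : piSchwartzBruhat (Fp L) (Fin n')) :
    adelicMpCont.omega (Fp L) (Fin n') (adelicGram (Fp L) e₁ (realDiagonal L dV₁ hdV₁) TW)
        (pairSplitting (Fp L) L (IsCMField.complexConj L) N' 1 e₁ (Matrix.diagonal dV₁) JW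
          (chiSplittingLine L e₁ dV₁ hdV₁ hdV₁0 χ hχu hχs TW hWd JW hJW) (k, u)) Φ =
      adelicMpCont.omega (Fp L) (Fin n') (gramA L e₁ dV₁ hdV₁ (lineW L TW) (complexConj_lineW L TW))
        (pairSplitting (Fp L) L (IsCMField.complexConj L) N' 1 e₁ (Matrix.diagonal dV₁) (Matrix.diagonal (lineW L TW))
          (chiSplitting L e₁ dV₁ hdV₁ hdV₁0 (lineW L TW) (complexConj_lineW L TW) (lineW_ne_zero L TW hWd) χ hχu hχs)
          (k, (MulEquiv.subgroupCongr
            (congrArg (UnitaryGroup.adelic (Fp L) L (IsCMField.complexConj L) 1) (diagonal_lineW L TW hJW))).symm u)) Φ :=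
  omega_pairSplitting_splittingCongr (realDiagonal_lineW L TW) (diagonal_lineW L TW hJW)
    (chiSplitting L e₁ dV₁ hdV₁ hdV₁0 (lineW L TW) (complexConj_lineW L TW) (lineW_ne_zero L TW hWd) χ hχu hχs) k u Φ

end Line

end Literature.NumberTheory.Automorphic.Liu2021.Def411WeilCarriersDoubling

/-! ## §4 The seam is invariant under a rational change of frame of `V` -/

namespace Literature.NumberTheory.Automorphic.Liu2021

open _root_.MeasureTheory
open Literature.NumberTheory.Automorphic Literature.NumberTheory.Automorphic.UnitaryGroup
open Literature.NumberTheory.Automorphic.UnitaryGroup.CotangentForms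
open Literature.NumberTheory.Automorphic.IdeleClassGroup
open Literature.NumberTheory.Automorphic.Liu2021.Def411WeilCarriers
open Literature.NumberTheory.Automorphic.Liu2021.Def411WeilCarriersDoubling
open Literature.NumberTheory.GelbartRogawski1991 Literature.NumberTheory.GelbartRogawski1991.UnitaryDualPair
open Literature.NumberTheory.GelbartRogawski1991.GRConstruction
open Literature.NumberTheory.Weil1964
open Literature.NumberTheory.GaloisRepresentations
open Literature.RepresentationTheory.HarrisKudlaSweet1996
open Literature.RepresentationTheory.Liu2021
open Literature.RepresentationTheory.HeisenbergGroup

section Frame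

variable (L : Type) [Field L] [NumberField L] [IsCMField L] (N : ℕ) (H : Matrix (Fin N) (Fin N) L)
  {n₂ : ℕ} (e₁ : Fin N × Fin 1 ≃ Fin n₂)
  (dV' : Fin N → L) (hdV' : ∀ i, IsCMField.complexConj L (dV' i) = dV' i) (hdV'0 : ∀ i, dV' i ≠ 0)
  (dV : Fin N → L) (hdV : ∀ i, IsCMField.complexConj L (dV i) = dV i) (hdV0 : ∀ i, dV i ≠ 0)
  {μA : Measure (adelicGroupData (↥(maximalRealSubfield L)) L (IsCMField.complexConj L) N H).automorphicQuotient}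
  [(adelicGroupData (↥(maximalRealSubfield L)) L (IsCMField.complexConj L) N H).IsAutomorphicMeasure μA]
  (μ : Literature.NumberTheory.Automorphic.IdeleClassGroup L →ₜ* Circle) (hμ : IsConjugateSymplectic L μ)
  (a : (↥(maximalRealSubfield L))ˣ)

/-- **THE SEAM DOES NOT SEE THE RATIONAL FRAME OF `V`** (brick (L-T2)).  For two real diagonal frames `d_V′`, `d_V` related by a
rational ISOMETRY `B` (`ᵗ(c̄B)·(diag d_V′)·B = diag d_V`, the socket form of ★ `chiSplittingFrameTransport`) and the same line `⟨a⟩`: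
if `P` meets the theta lift from `⟨a⟩` in the frame `d_V′` along `ιA′`, it meets it in the frame `d_V` along `Ad(B⁻¹ ⊗ 1) ∘ ιA′`
(`adelicIsometryConj (aOfB B)`).  PROOF = §2 at `θ_V := Ad(B⁻¹ ⊗ 1)`, `θ_W := id`, `R := R_{e₁} ∘ ω(r_Kron) ∘ R_{e₁}⁻¹` with
`r_Kron = r_{L⁺}(Ad(B⁻¹ ⊗ 1))` Weil's Θ-FIXING rational lift (★ `rKron`, ★ `thetaDist_omega_ratPointsThetaLiftCont`, ★ `thetaDistLM_piSBReindex`),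
the operator identity being ★ `hω_of_T4` at the HYPOTHESIS-FREE doubled isometry transport ★ `conjSplitting_doubledWeilRep_comp_thetaD`
([Kudla1994, Thm. 3.1]: the `χ`-normalised doubled Weil representation is unique, so it commutes with isometries), read at the line through §3.
[cite: Liu2021, Def. 4.11 (l. 2092–2096); App. D §D.1 Step 2 (l. 5219)] [cite: GelbartRogawski1991, §3.1 Prop. 3.1.1 p. 455, Remark p. 457]
[cite: Kudla1994, §2 (doubled space, Siegel parabolic), Thm. 3.1] [cite: Weil1964, Chap. III n° 41 Thm 6 p. 193] -/
theorem MeetsThetaLiftFromLine.frameTransport (B : GL (Fin N) L)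
    (hB : formCongr ((IsCMField.complexConj L : L ≃ₐ[Fp L] L) : L →+* L) B ((1 : L) • Matrix.diagonal dV') = Matrix.diagonal dV)
    (hρ : HasThetaMajorants fun
      (p : ↥(UnitaryGroup.adelic (↥(maximalRealSubfield L)) L (IsCMField.complexConj L) N (Matrix.diagonal dV)) ×
        ↥(UnitaryGroup.adelic (↥(maximalRealSubfield L)) L (IsCMField.complexConj L) 1 (JW (↥(maximalRealSubfield L)) L a)))
      (Φ : piSchwartzBruhat (↥(maximalRealSubfield L)) (Fin n₂)) =>
        pairRep (↥(maximalRealSubfield L)) L (IsCMField.complexConj L) N 1 e₁ (Matrix.diagonal dV) (JW (↥(maximalRealSubfield L)) L a)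
          (chiSplittingLine L e₁ dV hdV hdV0 (toHeckeCharacter L μ) (isUnitary_toHeckeCharacter L μ)
            ((isOscillatorChar_toHeckeCharacter_iff μ).mpr hμ) (TW (↥(maximalRealSubfield L)) a)
            (isUnit_det_TW (↥(maximalRealSubfield L)) a) (JW (↥(maximalRealSubfield L)) L a) (JW_eq (↥(maximalRealSubfield L)) L a))
          p Φ)
    [CompactSpace (↥(UnitaryGroup.adelic (↥(maximalRealSubfield L)) L (IsCMField.complexConj L) N (Matrix.diagonal dV')) ⧸
      (UnitaryGroup.toAdelic (↥(maximalRealSubfield L)) L (IsCMField.complexConj L) N (Matrix.diagonal dV')).range)]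
    [CompactSpace (↥(UnitaryGroup.adelic (↥(maximalRealSubfield L)) L (IsCMField.complexConj L) N (Matrix.diagonal dV)) ⧸
      (UnitaryGroup.toAdelic (↥(maximalRealSubfield L)) L (IsCMField.complexConj L) N (Matrix.diagonal dV)).range)]
    (P : DiscreteAutomorphicRep (adelicGroupData (↥(maximalRealSubfield L)) L (IsCMField.complexConj L) N H) μA)
    (ιA' : (adelicGroupData (↥(maximalRealSubfield L)) L (IsCMField.complexConj L) N H).Adelic →*
      ↥(UnitaryGroup.adelic (↥(maximalRealSubfield L)) L (IsCMField.complexConj L) N (Matrix.diagonal dV')))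
    (h : MeetsThetaLiftFromLine L N H e₁ dV' hdV' hdV'0 P μ hμ a ιA') :
    MeetsThetaLiftFromLine L N H e₁ dV hdV hdV0 P μ hμ a
      ((adelicIsometryConj (Fp L) L (IsCMField.complexConj L) N (aOfB L B) (aOfB_isometry L dV dV' B hB)).comp ιA') := by
  -- the model W-frame of the line, the rational Gram transporter, Weil's Θ-fixing lift at the Kronecker index
  obtain ⟨C₀, C, hCC₀, hC⟩ := exists_gramTransporter L dV hdV hdV0 dV' hdV' hdV'0 (lineW L (TW (Fp L) a))
    (complexConj_lineW L (TW (Fp L) a)) (lineW_ne_zero L (TW (Fp L) a) (isUnit_det_TW (Fp L) a))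
  have hω := hω_of_T4 L e₁ dV hdV hdV0 dV' hdV' hdV'0 (lineW L (TW (Fp L) a)) (complexConj_lineW L (TW (Fp L) a))
    (lineW_ne_zero L (TW (Fp L) a) (isUnit_det_TW (Fp L) a)) B hB hCC₀ hC (toHeckeCharacter L μ) (isUnitary_toHeckeCharacter L μ)
    ((isOscillatorChar_toHeckeCharacter_iff μ).mpr hμ)
    (conjSplitting_doubledWeilRep_comp_thetaD L e₁ dV hdV hdV0 dV' hdV' hdV'0 (lineW L (TW (Fp L) a))
      (complexConj_lineW L (TW (Fp L) a)) (lineW_ne_zero L (TW (Fp L) a) (isUnit_det_TW (Fp L) a)) hCC₀ hC B hB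
      (toHeckeCharacter L μ) (isUnitary_toHeckeCharacter L μ) ((isOscillatorChar_toHeckeCharacter_iff μ).mpr hμ))
  let R : piSchwartzBruhat (Fp L) (Fin n₂) →ₗ[ℂ] piSchwartzBruhat (Fp L) (Fin n₂) :=
    (piSBReindex (Fp L) e₁).toLinearMap ∘ₗ
      (adelicMpCont.omega (Fp L) (Fin N × Fin 1) _
        (rKron L dV hdV hdV0 dV' hdV' (lineW L (TW (Fp L) a)) (complexConj_lineW L (TW (Fp L) a))
          (lineW_ne_zero L (TW (Fp L) a) (isUnit_det_TW (Fp L) a)) (coe_aOfB L B) (aOfB_isometry L dV dV' B hB) hCC₀ hC)) ∘ₗ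
      (piSBReindex (Fp L) e₁).symm.toLinearMap
  have hRapp : ∀ Φ, R Φ = piSBReindex (Fp L) e₁ (adelicMpCont.omega (Fp L) (Fin N × Fin 1) _
      (rKron L dV hdV hdV0 dV' hdV' (lineW L (TW (Fp L) a)) (complexConj_lineW L (TW (Fp L) a))
        (lineW_ne_zero L (TW (Fp L) a) (isUnit_det_TW (Fp L) a)) (coe_aOfB L B) (aOfB_isometry L dV dV' B hB) hCC₀ hC)
      ((piSBReindex (Fp L) e₁).symm Φ)) :=
    fun _ => rfl
  -- `Θ ∘ R = Θ`
  have hΘ : ∀ Ψ : piSchwartzBruhat (Fp L) (Fin n₂), thetaDistLM (Fp L) (Fin n₂) (R Ψ) = thetaDistLM (Fp L) (Fin n₂) Ψ := fun Ψ => by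
    have hfix : thetaDist (Fp L) (Fin N × Fin 1)
        ((adelicMpCont.omega (Fp L) (Fin N × Fin 1) _
          (rKron L dV hdV hdV0 dV' hdV' (lineW L (TW (Fp L) a)) (complexConj_lineW L (TW (Fp L) a))
            (lineW_ne_zero L (TW (Fp L) a) (isUnit_det_TW (Fp L) a)) (coe_aOfB L B) (aOfB_isometry L dV dV' B hB) hCC₀ hC)
          ((piSBReindex (Fp L) e₁).symm Ψ) : piSchwartzBruhat (Fp L) (Fin N × Fin 1)) :
          (Fin N × Fin 1 → AdeleRing (𝓞 (Fp L)) (Fp L)) → ℂ) =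
        thetaDist (Fp L) (Fin N × Fin 1)
          (((piSBReindex (Fp L) e₁).symm Ψ : piSchwartzBruhat (Fp L) (Fin N × Fin 1)) :
            (Fin N × Fin 1 → AdeleRing (𝓞 (Fp L)) (Fp L)) → ℂ) :=
      thetaDist_omega_ratPointsThetaLiftCont (Fp L) (Fin N × Fin 1) _ _ _ _
    rw [hRapp, thetaDistLM_piSBReindex, thetaDistLM_apply, hfix, ← thetaDistLM_apply, piSBReindex_symm, thetaDistLM_piSBReindex]
  -- the operator identity at the line, from `hω_of_T4` through the bridge §3
  have hR : ∀ (k : ↥(UnitaryGroup.adelic (Fp L) L (IsCMField.complexConj L) N (Matrix.diagonal dV')))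
      (u : ↥(UnitaryGroup.adelic (Fp L) L (IsCMField.complexConj L) 1 (JW (Fp L) L a))) (Φ : piSchwartzBruhat (Fp L) (Fin n₂)),
      R (pairRep (Fp L) L (IsCMField.complexConj L) N 1 e₁ (Matrix.diagonal dV') (JW (Fp L) L a)
          (chiSplittingLine L e₁ dV' hdV' hdV'0 (toHeckeCharacter L μ) (isUnitary_toHeckeCharacter L μ)
            ((isOscillatorChar_toHeckeCharacter_iff μ).mpr hμ) (TW (Fp L) a) (isUnit_det_TW (Fp L) a) (JW (Fp L) L a) (JW_eq (Fp L) L a))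
          (k, u) Φ) =
        pairRep (Fp L) L (IsCMField.complexConj L) N 1 e₁ (Matrix.diagonal dV) (JW (Fp L) L a)
          (chiSplittingLine L e₁ dV hdV hdV0 (toHeckeCharacter L μ) (isUnitary_toHeckeCharacter L μ)
            ((isOscillatorChar_toHeckeCharacter_iff μ).mpr hμ) (TW (Fp L) a) (isUnit_det_TW (Fp L) a) (JW (Fp L) L a) (JW_eq (Fp L) L a))
          (adelicIsometryConj (Fp L) L (IsCMField.complexConj L) N (aOfB L B) (aOfB_isometry L dV dV' B hB) k,
            (MulEquiv.refl _) u) (R Φ) := fun k u Φ => by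
    have h1 := omega_pairSplitting_chiSplittingLine L e₁ dV' hdV' hdV'0 (toHeckeCharacter L μ) (isUnitary_toHeckeCharacter L μ)
      ((isOscillatorChar_toHeckeCharacter_iff μ).mpr hμ) (TW (Fp L) a) (isUnit_det_TW (Fp L) a) (JW (Fp L) L a) (JW_eq (Fp L) L a) k u Φ
    have h2 := omega_pairSplitting_chiSplittingLine L e₁ dV hdV hdV0 (toHeckeCharacter L μ) (isUnitary_toHeckeCharacter L μ)
      ((isOscillatorChar_toHeckeCharacter_iff μ).mpr hμ) (TW (Fp L) a) (isUnit_det_TW (Fp L) a) (JW (Fp L) L a) (JW_eq (Fp L) L a)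
      (adelicIsometryConj (Fp L) L (IsCMField.complexConj L) N (aOfB L B) (aOfB_isometry L dV dV' B hB) k) u (R Φ)
    have h3 := hω
      (adelicInl (Fp L) L (IsCMField.complexConj L) N 1 (Matrix.diagonal dV') (Matrix.diagonal (lineW L (TW (Fp L) a))) k *
        adelicInr (Fp L) L (IsCMField.complexConj L) N 1 (Matrix.diagonal dV') (Matrix.diagonal (lineW L (TW (Fp L) a)))
          ((MulEquiv.subgroupCongr (congrArg (UnitaryGroup.adelic (Fp L) L (IsCMField.complexConj L) 1)
            (diagonal_lineW L (TW (Fp L) a) (JW_eq (Fp L) L a)))).symm u))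
      ((piSBReindex (Fp L) e₁).symm Φ)
    have hΦ : (piSBReindex (Fp L) e₁) ((piSBReindex (Fp L) e₁).symm Φ) = Φ := LinearEquiv.apply_symm_apply _ _
    have hconj : adelicPairIsometryConjLeft (Fp L) L (IsCMField.complexConj L) N 1 (aOfB L B) (aOfB_isometry L dV dV' B hB)
        (adelicInl (Fp L) L (IsCMField.complexConj L) N 1 (Matrix.diagonal dV') (Matrix.diagonal (lineW L (TW (Fp L) a))) k *
          adelicInr (Fp L) L (IsCMField.complexConj L) N 1 (Matrix.diagonal dV') (Matrix.diagonal (lineW L (TW (Fp L) a)))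
            ((MulEquiv.subgroupCongr (congrArg (UnitaryGroup.adelic (Fp L) L (IsCMField.complexConj L) 1)
              (diagonal_lineW L (TW (Fp L) a) (JW_eq (Fp L) L a)))).symm u)) =
        adelicInl (Fp L) L (IsCMField.complexConj L) N 1 (Matrix.diagonal dV) (Matrix.diagonal (lineW L (TW (Fp L) a)))
            (adelicIsometryConj (Fp L) L (IsCMField.complexConj L) N (aOfB L B) (aOfB_isometry L dV dV' B hB) k) *
          adelicInr (Fp L) L (IsCMField.complexConj L) N 1 (Matrix.diagonal dV) (Matrix.diagonal (lineW L (TW (Fp L) a)))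
            ((MulEquiv.subgroupCongr (congrArg (UnitaryGroup.adelic (Fp L) L (IsCMField.complexConj L) 1)
              (diagonal_lineW L (TW (Fp L) a) (JW_eq (Fp L) L a)))).symm u) := by
      rw [map_mul, adelicPairIsometryConjLeft_adelicInl, adelicPairIsometryConjLeft_adelicInr]
    simp only [hΦ, hconj] at h3
    have hA := (pairRep_apply (Fp L) L (IsCMField.complexConj L) N 1 e₁ (Matrix.diagonal dV') (JW (Fp L) L a)
      (chiSplittingLine L e₁ dV' hdV' hdV'0 (toHeckeCharacter L μ) (isUnitary_toHeckeCharacter L μ)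
        ((isOscillatorChar_toHeckeCharacter_iff μ).mpr hμ) (TW (Fp L) a) (isUnit_det_TW (Fp L) a) (JW (Fp L) L a) (JW_eq (Fp L) L a))
      (k, u) Φ).trans h1
    simp only [pairSplitting_apply] at hA
    have hB' := (pairRep_apply (Fp L) L (IsCMField.complexConj L) N 1 e₁ (Matrix.diagonal dV) (JW (Fp L) L a)
      (chiSplittingLine L e₁ dV hdV hdV0 (toHeckeCharacter L μ) (isUnitary_toHeckeCharacter L μ)
        ((isOscillatorChar_toHeckeCharacter_iff μ).mpr hμ) (TW (Fp L) a) (isUnit_det_TW (Fp L) a) (JW (Fp L) L a) (JW_eq (Fp L) L a))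
      (adelicIsometryConj (Fp L) L (IsCMField.complexConj L) N (aOfB L B) (aOfB_isometry L dV dV' B hB) k, u) (R Φ)).trans h2
    simp only [pairSplitting_apply] at hB'
    have hu : (MulEquiv.refl (↥(UnitaryGroup.adelic (Fp L) L (IsCMField.complexConj L) 1 (JW (Fp L) L a)))) u = u := rfl
    simp only [hu, hB']
    simp only [hA, hRapp, h3, LinearEquiv.apply_symm_apply]
  refine MeetsThetaLiftFromLine.transport L N H e₁ e₁ dV' hdV' hdV'0 dV hdV hdV0 μ hμ a a
    (adelicIsometryConj (Fp L) L (IsCMField.complexConj L) N (aOfB L B) (aOfB_isometry L dV dV' B hB)) (MulEquiv.refl _)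
    continuous_id continuous_id ?_ R hΘ hR hρ P ιA' h
  exact Subgroup.map_id _

end Frame

end Literature.NumberTheory.Automorphic.Liu2021

end
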